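import Summits.Ventures.LatticeQCDFlow.Scaling.HubListsSharpLaw
import Summits.Ventures.LatticeQCDFlow.Scaling.UniversalPoincare
import Summits.Ventures.LatticeQCDFlow.Scaling.TreePoincare

/-!
HONEST FRAMING: exact (Metropolis-corrected) sampling algorithms for lattice gauge theory; figures
of merit are autocorrelation/cost numbers at stated couplings and volumes; no continuum-physics
claim.

# BinaryTreeSharpLaw — THE HEAP-ORDERED BINARY TREE OF EXCHANGES (level `r+1` listed with its parent `⌊r/2⌋`, `m = K`, the hot seat at the root): `max{K²/(2t), (K+1)/h} ≤ 1/ρ ≤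
# max{2L(K+1)K/t, 2(K+1)/h}` WITH `L = ⌊log₂(K+1)⌋`, PARTICIPATION `≥ K/(4L)`, HENCE **`((1−ρ)/ρ)·log((1−ν(u))·√(K/(4L))/4) ≤ t_mix(1/4) ≤ ⌈(1/ρ)·log(4h/ρ)⌉`** — THE TREE SITS AT
# `K²` BETWEEN THE STAR (`K`) AND THE LADDER (`K³`), UP TO `log K` (lean-2 GEN-48, ours)

Venture-side (OURS).  Cell `lqcd-flow` (pub-lqcd), unit `pub-lqcd-lean-2-g48`, 2026-09-01.  Chapter AI (the sizes of the Robin ground state), file 17 — parents AI5 `HubListsSharpLaw` (AI4's sharp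
law, `floorLog_mono`), AI7 `UniversalPoincare` (`connected_of_reachable`), AI19 `TreePoincare` (the parent-map Poincaré inequality).  The list `e_r = (⌊r/2⌋, r+1)`, `r < K` — the complete binary tree in heap order, filled level by
level, any `K ≥ 2` — is sized by the chapter's generic tools only: (§1) the ancestor chain `(k+1)/2^{n−j} − 1`, `j ≤ n = ⌊log₂(k+1)⌋ ≤ L`, joins `k` to the root in `≤ L` listed pairs, so the
list is connected; the heap order is a parent map `p k = ⌊(k−1)/2⌋` with depth `⌊log₂(k+1)⌋`, and AI19's tree Poincaré inequality (descendants crudely `≤ K+1`) gives `min{t/(2L(K+1)K), h/(2(K+1))} ≤ ρ`; (§2) AI1's cut ceiling with `A = {k ≠ 0}` (only the two root pairs cross): `ρK ≤ 2t/K`, i.e.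
`ρ ≤ 2t/K²`; AI2's participation bound with the two ceilings: `Σc/√(Σc²) ≥ √(K/(4L))`.  (§3) AI4's sharp law.  READING: `1/ρ` between `K²/(2t)` and `2L(K+1)K/t` in the swap channel —
a tree of exchanges relaxes like `K²` (star `K`, ladder `K³`); the remaining logarithm is the depth, the descendant bound being crude (`B = K+1`; subtree sizes would sharpen constants only at the root).
No definitions.

* §1 `btree_ne`, `btree_reachable`, `btree_connected`, `btree_parent_facts`, `btree_rho_ge`; §2 `btree_rho_le_cut`, `btree_participation_ge`; §3 `homBinaryTree_sharp_two_sided`.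

Literature grade (cell rule): OWN; nothing cited; no new bib keys.
-/

noncomputable section

open Finset Function Real
open Literature.Probability.MarkovChains

namespace Summit.Ventures.LatticeQCDFlow.Scaling

variable {S : Type*} [Fintype S] [DecidableEq S] {K : ℕ} {ν : S → ℝ} {M : Fin (K + 1) → S → S → ℝ} {w : Fin (K + 1) → ℝ} {t : ℝ}
  {P : (Fin (K + 1) → S) → (Fin (K + 1) → S) → ℝ}

/-! ## §1 The heap-ordered tree: chains and the rate floor -/

omit [Fintype S] [DecidableEq S] in
/-- The tree list has distinct endpoints. [ours] -/
theorem btree_ne (r : Fin K) :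
    ((fun r : Fin K => (((⟨(r : ℕ) / 2, by omega⟩ : Fin (K + 1)), r.succ) : Fin (K + 1) × Fin (K + 1))) r).1
      ≠ ((fun r : Fin K => (((⟨(r : ℕ) / 2, by omega⟩ : Fin (K + 1)), r.succ) : Fin (K + 1) × Fin (K + 1))) r).2 := by
  dsimp only
  intro h
  have := congrArg Fin.val h
  simp only [Fin.val_succ] at this
  omega

omit [Fintype S] [DecidableEq S] in
/-- **Every level `k` is joined to the root by its ancestor chain `(k+1)/2^{n−j} − 1`, `n = ⌊log₂(k+1)⌋ ≤ ⌊log₂(K+1)⌋`.** [ours] -/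
theorem btree_reachable (k : Fin (K + 1)) :
    ∃ n : ℕ, n ≤ Nat.log 2 (K + 1) ∧ ∃ γ : Fin (n + 1) → Fin (K + 1), γ 0 = 0 ∧ γ (Fin.last n) = k ∧
      ∀ j : Fin n, ∃ r : Fin K,
        (((fun r : Fin K => (((⟨(r : ℕ) / 2, by omega⟩ : Fin (K + 1)), r.succ) : Fin (K + 1) × Fin (K + 1))) r).1 = γ j.castSucc
          ∧ ((fun r : Fin K => (((⟨(r : ℕ) / 2, by omega⟩ : Fin (K + 1)), r.succ) : Fin (K + 1) × Fin (K + 1))) r).2 = γ j.succ)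
        ∨ (((fun r : Fin K => (((⟨(r : ℕ) / 2, by omega⟩ : Fin (K + 1)), r.succ) : Fin (K + 1) × Fin (K + 1))) r).1 = γ j.succ
          ∧ ((fun r : Fin K => (((⟨(r : ℕ) / 2, by omega⟩ : Fin (K + 1)), r.succ) : Fin (K + 1) × Fin (K + 1))) r).2 = γ j.castSucc) := by
  set n : ℕ := Nat.log 2 ((k : ℕ) + 1) with hn
  have hk1 : (k : ℕ) + 1 ≠ 0 := by omega
  have hlow : 2 ^ n ≤ (k : ℕ) + 1 := Nat.pow_log_le_self 2 hk1
  have hup : (k : ℕ) + 1 < 2 ^ (n + 1) := Nat.lt_pow_succ_log_self (by norm_num) _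
  refine ⟨n, Nat.log_mono_right (by have := k.2; omega), fun j => ⟨((k : ℕ) + 1) / 2 ^ (n - (j : ℕ)) - 1, ?_⟩, ?_, ?_, ?_⟩
  · have : ((k : ℕ) + 1) / 2 ^ (n - (j : ℕ)) ≤ (k : ℕ) + 1 := Nat.div_le_self _ _
    have := k.2; omega
  · -- the root: `(k+1)/2^n = 1`
    ext
    simp only [Fin.val_zero, Nat.sub_zero]
    have h1 : 1 ≤ ((k : ℕ) + 1) / 2 ^ n := (Nat.le_div_iff_mul_le (by positivity)).mpr (by simpa using hlow)
    have h2 : ((k : ℕ) + 1) / 2 ^ n < 2 := (Nat.div_lt_iff_lt_mul (by positivity)).mpr (by rw [pow_succ] at hup; linarith)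
    omega
  · ext
    simp only [Fin.val_last, Nat.sub_self, pow_zero, Nat.div_one]
    omega
  · intro j
    have hj := j.2
    -- `x = (k+1)/2^(n-j-1) ≥ 2`, child `b = x − 1`, parent `a = x/2 − 1 = (k+1)/2^(n-j) − 1`
    set x : ℕ := ((k : ℕ) + 1) / 2 ^ (n - (j : ℕ) - 1) with hx
    have hx2 : 2 ≤ x := by
      rw [hx, Nat.le_div_iff_mul_le (by positivity)]
      calc 2 * 2 ^ (n - (j : ℕ) - 1) = 2 ^ (n - (j : ℕ)) := by rw [← pow_succ']; congr 1; omega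
        _ ≤ 2 ^ n := Nat.pow_le_pow_right (by norm_num) (by omega)
        _ ≤ (k : ℕ) + 1 := hlow
    have hxle : x ≤ (k : ℕ) + 1 := Nat.div_le_self _ _
    have hpar : ((k : ℕ) + 1) / 2 ^ (n - (j : ℕ)) = x / 2 := by
      rw [hx, Nat.div_div_eq_div_mul, ← pow_succ]
      congr 2; omega
    refine ⟨⟨x - 2, by have := k.2; omega⟩, Or.inl ⟨?_, ?_⟩⟩
    · ext
      simp only [Fin.val_castSucc]
      rw [hpar]
      omega
    · ext
      simp only [Fin.val_succ]
      have : n - ((j : ℕ) + 1) = n - (j : ℕ) - 1 := by omega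
      rw [this, ← hx]
      omega

omit [Fintype S] [DecidableEq S] in
/-- **The heap-ordered tree is connected.** [ours] -/
theorem btree_connected (A : Finset (Fin (K + 1))) (hA : A.Nonempty) (hAu : A ≠ univ) :
    ∃ r : Fin K, (((fun r : Fin K => (((⟨(r : ℕ) / 2, by omega⟩ : Fin (K + 1)), r.succ) : Fin (K + 1) × Fin (K + 1))) r).1 ∈ A
        ∧ ((fun r : Fin K => (((⟨(r : ℕ) / 2, by omega⟩ : Fin (K + 1)), r.succ) : Fin (K + 1) × Fin (K + 1))) r).2 ∉ A)
      ∨ (((fun r : Fin K => (((⟨(r : ℕ) / 2, by omega⟩ : Fin (K + 1)), r.succ) : Fin (K + 1) × Fin (K + 1))) r).2 ∈ A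
        ∧ ((fun r : Fin K => (((⟨(r : ℕ) / 2, by omega⟩ : Fin (K + 1)), r.succ) : Fin (K + 1) × Fin (K + 1))) r).1 ∉ A) :=
  connected_of_reachable _ btree_reachable A hA hAu

omit [Fintype S] [DecidableEq S] in
/-- The heap order as a parent map with depths: `p k = ⌊(k−1)/2⌋`, `d k = ⌊log₂(k+1)⌋`; `p 0 = 0`, `d k = 0 ↔ k = 0`, `d(p k) + 1 = d k` for `k ≠ 0`, `d ≤ ⌊log₂(K+1)⌋`, every tree pair is the entry
`k − 1`. [ours] -/
theorem btree_parent_facts :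
    ((fun k : Fin (K + 1) => (⟨((k : ℕ) - 1) / 2, by have := k.2; omega⟩ : Fin (K + 1))) 0 = 0)
    ∧ (∀ k : Fin (K + 1), Nat.log 2 ((k : ℕ) + 1) = 0 ↔ k = 0)
    ∧ (∀ k : Fin (K + 1), k ≠ 0 → Nat.log 2 ((((fun k : Fin (K + 1) => (⟨((k : ℕ) - 1) / 2, by have := k.2; omega⟩ : Fin (K + 1))) k : Fin (K + 1)) : ℕ) + 1) + 1 = Nat.log 2 ((k : ℕ) + 1))
    ∧ (∀ k : Fin (K + 1), Nat.log 2 ((k : ℕ) + 1) ≤ Nat.log 2 (K + 1))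
    ∧ (∀ k : Fin (K + 1), k ≠ 0 → ∃ r : Fin K,
        (((fun r : Fin K => (((⟨(r : ℕ) / 2, by omega⟩ : Fin (K + 1)), r.succ) : Fin (K + 1) × Fin (K + 1))) r).1
            = (fun k : Fin (K + 1) => (⟨((k : ℕ) - 1) / 2, by have := k.2; omega⟩ : Fin (K + 1))) k
          ∧ ((fun r : Fin K => (((⟨(r : ℕ) / 2, by omega⟩ : Fin (K + 1)), r.succ) : Fin (K + 1) × Fin (K + 1))) r).2 = k)
        ∨ (((fun r : Fin K => (((⟨(r : ℕ) / 2, by omega⟩ : Fin (K + 1)), r.succ) : Fin (K + 1) × Fin (K + 1))) r).1 = k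
          ∧ ((fun r : Fin K => (((⟨(r : ℕ) / 2, by omega⟩ : Fin (K + 1)), r.succ) : Fin (K + 1) × Fin (K + 1))) r).2
            = (fun k : Fin (K + 1) => (⟨((k : ℕ) - 1) / 2, by have := k.2; omega⟩ : Fin (K + 1))) k)) := by
  refine ⟨by ext; simp, fun k => ?_, fun k hk => ?_, fun k => Nat.log_mono_right (by have := k.2; omega), fun k hk => ?_⟩
  · rw [Nat.log_eq_zero_iff, Fin.ext_iff, Fin.val_zero]; omega
  · have hk1 : (k : ℕ) ≠ 0 := fun h => hk (Fin.ext h)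
    dsimp only
    have : ((k : ℕ) - 1) / 2 + 1 = ((k : ℕ) + 1) / 2 := by omega
    rw [this, Nat.log_div_base]
    have : 1 ≤ Nat.log 2 ((k : ℕ) + 1) := Nat.log_pos (by norm_num) (by omega)
    omega
  · have hk1 : (k : ℕ) ≠ 0 := fun h => hk (Fin.ext h)
    refine ⟨⟨(k : ℕ) - 1, by have := k.2; omega⟩, Or.inl ⟨?_, ?_⟩⟩
    · ext; simp
    · ext; simp only [Fin.val_succ]; omega

omit [Fintype S] [DecidableEq S] in
/-- **THE TREE'S RATE FLOOR: `min{t/(2L(K+1)K), h/(2(K+1))} ≤ ρ`, `L = ⌊log₂(K+1)⌋`** for a positive solution (`K ≥ 1`, `t, h > 0`) — file 19's parent-map Poincaré with the crude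
descendant bound `B = K+1` (one logarithm better than file 7's chains). [ours] -/
theorem btree_rho_ge (hK : 1 ≤ K) (ht : 0 < t) {h ρ : ℝ} (hh : 0 < h) {c : Fin (K + 1) → ℝ} (hc : ∀ k, 0 < c k)
    (hvertex : ∀ k : Fin (K + 1), t / K * ∑ r : Fin K, ((if k = ((fun r : Fin K => (((⟨(r : ℕ) / 2, by omega⟩ : Fin (K + 1)), r.succ) : Fin (K + 1) × Fin (K + 1))) r).1
        then c ((fun r : Fin K => (((⟨(r : ℕ) / 2, by omega⟩ : Fin (K + 1)), r.succ) : Fin (K + 1) × Fin (K + 1))) r).2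
          - c ((fun r : Fin K => (((⟨(r : ℕ) / 2, by omega⟩ : Fin (K + 1)), r.succ) : Fin (K + 1) × Fin (K + 1))) r).1 else 0)
      + (if k = ((fun r : Fin K => (((⟨(r : ℕ) / 2, by omega⟩ : Fin (K + 1)), r.succ) : Fin (K + 1) × Fin (K + 1))) r).2
        then c ((fun r : Fin K => (((⟨(r : ℕ) / 2, by omega⟩ : Fin (K + 1)), r.succ) : Fin (K + 1) × Fin (K + 1))) r).1
          - c ((fun r : Fin K => (((⟨(r : ℕ) / 2, by omega⟩ : Fin (K + 1)), r.succ) : Fin (K + 1) × Fin (K + 1))) r).2 else 0))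
      - (if k = 0 then h * c k else 0) = -ρ * c k) :
    min (t / (2 * ((Nat.log 2 (K + 1) : ℕ) : ℝ) * (((K + 1 : ℕ) : ℕ) : ℝ) * K)) (h / (2 * ((K : ℝ) + 1))) ≤ ρ := by
  have hL : 1 ≤ Nat.log 2 (K + 1) := Nat.log_pos (by norm_num) (by omega)
  obtain ⟨hp0, hd0, hdp, hdL, hedge⟩ := btree_parent_facts (K := K)
  exact tree_rho_ge _ (fun k : Fin (K + 1) => (⟨((k : ℕ) - 1) / 2, by have := k.2; omega⟩ : Fin (K + 1))) (fun k : Fin (K + 1) => Nat.log 2 ((k : ℕ) + 1))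
    hK ht hh hc hvertex hp0 hd0 hdp hL (by omega) hdL hedge (B := K + 1)
    (fun a _ s _ => le_trans (card_le_univ s) (by rw [Fintype.card_fin]))

/-! ## §2 The cut at the root and the participation -/

omit [Fintype S] [DecidableEq S] in
/-- **THE CUT AT THE ROOT: `ρ ≤ 2t/K²`** (`A = {k ≠ 0}` is left by the two root pairs only; positive solution, `t ≥ 0`, `K ≥ 1`). [ours] -/
theorem btree_rho_le_cut (hK : 1 ≤ K) (ht : 0 ≤ t) {h ρ : ℝ} {c : Fin (K + 1) → ℝ} (hc : ∀ k, 0 < c k)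
    (hvertex : ∀ k : Fin (K + 1), t / K * ∑ r : Fin K, ((if k = ((fun r : Fin K => (((⟨(r : ℕ) / 2, by omega⟩ : Fin (K + 1)), r.succ) : Fin (K + 1) × Fin (K + 1))) r).1
        then c ((fun r : Fin K => (((⟨(r : ℕ) / 2, by omega⟩ : Fin (K + 1)), r.succ) : Fin (K + 1) × Fin (K + 1))) r).2
          - c ((fun r : Fin K => (((⟨(r : ℕ) / 2, by omega⟩ : Fin (K + 1)), r.succ) : Fin (K + 1) × Fin (K + 1))) r).1 else 0)
      + (if k = ((fun r : Fin K => (((⟨(r : ℕ) / 2, by omega⟩ : Fin (K + 1)), r.succ) : Fin (K + 1) × Fin (K + 1))) r).2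
        then c ((fun r : Fin K => (((⟨(r : ℕ) / 2, by omega⟩ : Fin (K + 1)), r.succ) : Fin (K + 1) × Fin (K + 1))) r).1
          - c ((fun r : Fin K => (((⟨(r : ℕ) / 2, by omega⟩ : Fin (K + 1)), r.succ) : Fin (K + 1) × Fin (K + 1))) r).2 else 0))
      - (if k = 0 then h * c k else 0) = -ρ * c k) :
    ρ ≤ 2 * t / (K : ℝ) ^ 2 := by
  classical
  have hKpos : (0 : ℝ) < K := Nat.cast_pos.mpr (by omega)
  have hcut := groundState_rho_le_cut _ hc ht hvertex (univ.erase 0)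
  rw [if_neg (by simp), add_zero, card_erase_of_mem (mem_univ _), card_univ, Fintype.card_fin, Nat.add_sub_cancel] at hcut
  -- the crossing pairs are among `r < 2`
  have hsub : (univ.filter fun r : Fin K =>
        (((fun r : Fin K => (((⟨(r : ℕ) / 2, by omega⟩ : Fin (K + 1)), r.succ) : Fin (K + 1) × Fin (K + 1))) r).1 ∈ (univ.erase (0 : Fin (K + 1)))
          ∧ ((fun r : Fin K => (((⟨(r : ℕ) / 2, by omega⟩ : Fin (K + 1)), r.succ) : Fin (K + 1) × Fin (K + 1))) r).2 ∉ (univ.erase (0 : Fin (K + 1))))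
        ∨ (((fun r : Fin K => (((⟨(r : ℕ) / 2, by omega⟩ : Fin (K + 1)), r.succ) : Fin (K + 1) × Fin (K + 1))) r).2 ∈ (univ.erase (0 : Fin (K + 1)))
          ∧ ((fun r : Fin K => (((⟨(r : ℕ) / 2, by omega⟩ : Fin (K + 1)), r.succ) : Fin (K + 1) × Fin (K + 1))) r).1 ∉ (univ.erase (0 : Fin (K + 1)))))
      ⊆ univ.filter (fun r : Fin K => (r : ℕ) < 2) := by
    intro r hr
    rw [mem_filter] at hr ⊢
    refine ⟨mem_univ _, ?_⟩
    rcases hr.2 with ⟨_, h2⟩ | ⟨_, h1⟩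
    · exfalso; apply h2; rw [mem_erase]; exact ⟨Fin.succ_ne_zero r, mem_univ _⟩
    · rw [mem_erase, not_and_or, not_not] at h1
      rcases h1 with h1 | h1
      · have := congrArg Fin.val h1
        simp only [Fin.val_zero] at this
        omega
      · exact absurd (mem_univ _) h1
  have hcard2 : ((univ.filter fun r : Fin K => (r : ℕ) < 2).card : ℝ) ≤ 2 := by
    have : (univ.filter fun r : Fin K => (r : ℕ) < 2).card ≤ (range 2).card :=
      Finset.card_le_card_of_injOn (fun r => (r : ℕ)) (fun r hr => by rw [mem_coe, mem_filter] at hr; exact mem_range.mpr hr.2)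
        (fun a _ b _ hab => Fin.ext hab)
    rw [card_range] at this
    exact_mod_cast this
  have hcardle := Nat.cast_le (α := ℝ).mpr (card_le_card hsub)
  have hstep : ρ * (K : ℝ) ≤ t / K * 2 := by
    calc ρ * (K : ℝ) ≤ t / K * _ := hcut
      _ ≤ t / K * 2 := mul_le_mul_of_nonneg_left (le_trans hcardle hcard2) (div_nonneg ht hKpos.le)
  rw [le_div_iff₀ (by positivity)]
  have : ρ * (K : ℝ) ^ 2 = (ρ * K) * K := by ring
  rw [this]
  calc ρ * (K : ℝ) * K ≤ t / K * 2 * K := mul_le_mul_of_nonneg_right hstep hKpos.le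
    _ = 2 * t := by field_simp

omit [Fintype S] [DecidableEq S] in
/-- **THE PARTICIPATION OF THE TREE'S GROUND STATE: `√(K/(4L)) ≤ Σc/√(Σc²)`, `L = ⌊log₂(K+1)⌋`** (positive solution, `ρ > 0`, `K ≥ 1`, `t, h > 0`). [ours] -/
theorem btree_participation_ge (hK : 1 ≤ K) (ht : 0 < t) {h ρ : ℝ} (hh : 0 < h) (hρ : 0 < ρ) {c : Fin (K + 1) → ℝ} (hc : ∀ k, 0 < c k)
    (hvertex : ∀ k : Fin (K + 1), t / K * ∑ r : Fin K, ((if k = ((fun r : Fin K => (((⟨(r : ℕ) / 2, by omega⟩ : Fin (K + 1)), r.succ) : Fin (K + 1) × Fin (K + 1))) r).1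
        then c ((fun r : Fin K => (((⟨(r : ℕ) / 2, by omega⟩ : Fin (K + 1)), r.succ) : Fin (K + 1) × Fin (K + 1))) r).2
          - c ((fun r : Fin K => (((⟨(r : ℕ) / 2, by omega⟩ : Fin (K + 1)), r.succ) : Fin (K + 1) × Fin (K + 1))) r).1 else 0)
      + (if k = ((fun r : Fin K => (((⟨(r : ℕ) / 2, by omega⟩ : Fin (K + 1)), r.succ) : Fin (K + 1) × Fin (K + 1))) r).2
        then c ((fun r : Fin K => (((⟨(r : ℕ) / 2, by omega⟩ : Fin (K + 1)), r.succ) : Fin (K + 1) × Fin (K + 1))) r).1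
          - c ((fun r : Fin K => (((⟨(r : ℕ) / 2, by omega⟩ : Fin (K + 1)), r.succ) : Fin (K + 1) × Fin (K + 1))) r).2 else 0))
      - (if k = 0 then h * c k else 0) = -ρ * c k) :
    Real.sqrt ((K : ℝ) / (4 * ((Nat.log 2 (K + 1) : ℕ) : ℝ))) ≤ (∑ k : Fin (K + 1), c k) / Real.sqrt (∑ k : Fin (K + 1), c k ^ 2) := by
  have hKpos : (0 : ℝ) < K := Nat.cast_pos.mpr (by omega)
  have hL1 : 1 ≤ Nat.log 2 (K + 1) := Nat.log_pos (by norm_num) (by omega)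
  have hLpos : (0 : ℝ) < ((Nat.log 2 (K + 1) : ℕ) : ℝ) := Nat.cast_pos.mpr (by omega)
  have hL1r : (1 : ℝ) ≤ ((Nat.log 2 (K + 1) : ℕ) : ℝ) := by exact_mod_cast hL1
  set L : ℝ := ((Nat.log 2 (K + 1) : ℕ) : ℝ) with hLdef
  have hpart := groundState_participation_ge _ hK ht hρ hc hvertex (Nat.log 2 (K + 1)) btree_reachable
  refine le_trans (Real.sqrt_le_sqrt ?_) hpart
  have hcut := btree_rho_le_cut hK ht.le hc hvertex
  have hhot := groundState_rho_le_hot _ hc ht.le hvertex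
  have hm : (((K : ℕ) : ℝ)) = (K : ℝ) := rfl
  have hq : 0 < 1 + L * ((K : ℝ) * h / t) := by positivity
  rw [div_le_div_iff₀ (by positivity) (mul_pos hρ hq)]
  have hexp : (K : ℝ) * (ρ * (1 + L * ((K : ℝ) * h / t))) = (K : ℝ) * ρ + (K : ℝ) * ρ * L * K * h / t := by ring
  rw [hexp]
  have h1 : (K : ℝ) * ρ ≤ L * h := by nlinarith
  have h2 : (K : ℝ) * ρ * L * K * h / t ≤ 2 * L * h := by
    rw [div_le_iff₀ ht]
    have hρ' : ρ * (K : ℝ) ^ 2 ≤ 2 * t := by have := hcut; rwa [le_div_iff₀ (by positivity)] at this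
    have : (K : ℝ) * ρ * L * K * h = (ρ * (K : ℝ) ^ 2) * (L * h) := by ring
    rw [this]
    calc (ρ * (K : ℝ) ^ 2) * (L * h) ≤ (2 * t) * (L * h) := mul_le_mul_of_nonneg_right hρ' (by positivity)
      _ = 2 * L * h * t := by ring
  nlinarith

/-! ## §3 The sharp law on the tree -/

/-- **THE HOMOGENEOUS EXCHANGE SCHEME ON THE HEAP-ORDERED BINARY TREE:** `K ≥ 1`, `0 < t < 1`, `w` a probability vector with `w_0 > 0`, one positive law `ν`, exact hot sampler, idle cold
kernels, `P = t·ptGraphSwap ν^{⊗} (r ↦ (⌊r/2⌋, r+1)) 1 + (1−t)·prodKernel w M`, `h = (1−t)w_0`, `L = ⌊log₂(K+1)⌋`; then there is `ρ` with `K²/(2t) ≤ 1/ρ`, `(K+1)/h ≤ 1/ρ`,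
`min{t/(2L(K+1)K), h/(2(K+1))} ≤ ρ` and, for every content `u`, **`((1−ρ)/ρ)·log((1−ν(u))·√(K/(4L))/4) ≤ t_mix(1/4) ≤ ⌈(1/ρ)·log(4h/ρ)⌉`**. [ours] -/
theorem homBinaryTree_sharp_two_sided (hK : 1 ≤ K) (hν : ∀ v, 0 < ν v) (hν1 : ∑ v, ν v = 1) (hM0 : ∀ u v, M 0 u v = ν v)
    (hidle : ∀ i : Fin K, ∀ u v, M i.succ u v = if v = u then 1 else 0) (hw0 : ∀ k, 0 ≤ w k) (hw00 : 0 < w 0) (hw1 : ∑ k, w k = 1) (ht0 : 0 < t) (ht1 : t < 1)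
    (hP : ∀ x y, P x y = t * ptGraphSwap (fun _ : Fin (K + 1) => ν)
        (fun r : Fin K => (((⟨(r : ℕ) / 2, by omega⟩ : Fin (K + 1)), r.succ) : Fin (K + 1) × Fin (K + 1))) (fun _ => Equiv.refl S) x y
      + (1 - t) * prodKernel w M x y) (u : S) :
    ∃ ρ : ℝ, 0 < ρ ∧ (K : ℝ) ^ 2 / (2 * t) ≤ 1 / ρ ∧ ((K : ℝ) + 1) / ((1 - t) * w 0) ≤ 1 / ρ ∧
      min (t / (2 * ((Nat.log 2 (K + 1) : ℕ) : ℝ) * (((K + 1 : ℕ) : ℕ) : ℝ) * K)) ((1 - t) * w 0 / (2 * ((K : ℝ) + 1))) ≤ ρ ∧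
      (1 - ρ) / ρ * Real.log ((1 - ν u) * Real.sqrt ((K : ℝ) / (4 * ((Nat.log 2 (K + 1) : ℕ) : ℝ))) / 4) ≤ (mixingTime P (tensorFun (fun _ : Fin (K + 1) => ν)) (1 / 4) : ℝ) ∧
      mixingTime P (tensorFun (fun _ : Fin (K + 1) => ν)) (1 / 4) ≤ ⌈1 / ρ * Real.log (4 * ((1 - t) * w 0) / ρ)⌉₊ := by
  have hKpos : (0 : ℝ) < K := Nat.cast_pos.mpr (by omega)
  have hhh : 0 < (1 - t) * w 0 := mul_pos (by linarith) hw00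
  have hLpos : (0 : ℝ) < ((Nat.log 2 (K + 1) : ℕ) : ℝ) := Nat.cast_pos.mpr (Nat.log_pos (by norm_num) (by omega))
  have he := btree_ne (K := K)
  obtain ⟨c, ρ, hcpos, hcS, hρ0, hρle, hvertex⟩ := graph_groundState_exists
    (fun r : Fin K => (((⟨(r : ℕ) / 2, by omega⟩ : Fin (K + 1)), r.succ) : Fin (K + 1) × Fin (K + 1))) (t := t) (h := (1 - t) * w 0) hK ht0 hhh btree_connected
  have htwo := graphScheme_sharp_two_sided_mode
    (fun r : Fin K => (((⟨(r : ℕ) / 2, by omega⟩ : Fin (K + 1)), r.succ) : Fin (K + 1) × Fin (K + 1))) hK he hν hν1 hM0 hidle hw0 hw00 hw1 ht0 ht1 hP hρ0 hcpos hvertex u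
  have hcut := btree_rho_le_cut hK ht0.le hcpos hvertex
  have hfloorρ := btree_rho_ge hK ht0 hhh hcpos hvertex
  have hpart := btree_participation_ge hK ht0 hhh hρ0 hcpos hvertex
  have hρ1 : ρ < 1 := by
    have hw01 : w 0 ≤ 1 := by
      calc w 0 ≤ ∑ k, w k := Finset.single_le_sum (fun k _ => hw0 k) (mem_univ 0)
        _ = 1 := hw1
    have : (1 - t) * w 0 / ((K : ℝ) + 1) ≤ (1 - t) * w 0 := div_le_self hhh.le (by linarith)
    nlinarith
  refine ⟨ρ, hρ0, ?_, ?_, hfloorρ, le_trans ?_ htwo.1, htwo.2⟩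
  · rw [div_le_div_iff₀ (by positivity) hρ0, one_mul]
    have := hcut
    rw [le_div_iff₀ (by positivity)] at this
    linarith
  · rw [div_le_div_iff₀ hhh hρ0, one_mul]
    calc ((K : ℝ) + 1) * ρ ≤ ((K : ℝ) + 1) * ((1 - t) * w 0 / ((K : ℝ) + 1)) := mul_le_mul_of_nonneg_left hρle (by linarith)
      _ = (1 - t) * w 0 := by field_simp
  · have hνu : ν u ≤ 1 := by
      calc ν u ≤ ∑ v, ν v := Finset.single_le_sum (fun v _ => (hν v).le) (mem_univ u)
        _ = 1 := hν1
    have hcoef : 0 ≤ (1 - ρ) / ρ := div_nonneg (by linarith) hρ0.le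
    rcases eq_or_lt_of_le hνu with heq | hlt
    · rw [heq]; simp
    · have hA : 0 < (1 - ν u) * Real.sqrt ((K : ℝ) / (4 * ((Nat.log 2 (K + 1) : ℕ) : ℝ))) / 4 := by
        have : 0 < Real.sqrt ((K : ℝ) / (4 * ((Nat.log 2 (K + 1) : ℕ) : ℝ))) := Real.sqrt_pos.mpr (by positivity)
        have : 0 < 1 - ν u := by linarith
        positivity
      refine floorLog_mono hcoef hA ?_
      have h4 : (1 - ν u) * Real.sqrt ((K : ℝ) / (4 * ((Nat.log 2 (K + 1) : ℕ) : ℝ))) / 4 = (1 - ν u) / 4 * Real.sqrt ((K : ℝ) / (4 * ((Nat.log 2 (K + 1) : ℕ) : ℝ))) := by ring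
      have h5 : (1 - ν u) * (∑ k : Fin (K + 1), c k) / (4 * Real.sqrt (∑ k : Fin (K + 1), c k ^ 2))
          = (1 - ν u) / 4 * ((∑ k : Fin (K + 1), c k) / Real.sqrt (∑ k : Fin (K + 1), c k ^ 2)) := by ring
      rw [h4, h5]
      exact mul_le_mul_of_nonneg_left hpart (by linarith)

end Summit.Ventures.LatticeQCDFlow.Scaling

end
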